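import Summits.HodgeConjecture.HodgeConjecture.Theses.TropicalWeilObstruction
import Literature.AlgebraicGeometry.Motives.HyperbolicWeilType
import Literature.AlgebraicGeometry.HodgeTheory.HyperbolicWeilTypeBalanced
import Literature.AlgebraicGeometry.HodgeTheory.WeilClassesRationalPlane
import Literature.AlgebraicGeometry.HodgeTheory.WeilClassesPolarizationOrthogonal
import Literature.AlgebraicGeometry.HodgeTheory.WeilClassesDescendingAssembly
import Literature.AlgebraicGeometry.HodgeTheory.WeilTypePeriodPoint
import Literature.AlgebraicGeometry.HodgeTheory.HodgeRiemannDegreeOneProofs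
import HarnessLib

/-!
# Crux `MumfordWeilShadow` (stmt-HodgeConjecture-18479), line `birth` — stub
# `stub_weilHodgeTriple`: THE CUP-NON-DEGENERATE WEIL–HODGE TRIPLE OF A HYPERBOLIC WEIL EIGHTFOLD

Route `HodgeConjecture/TropicalWeilObstruction`; registered skeleton `Cruxes/MumfordWeilShadow/Lines/birth.lean`
(`MumfordWeilShadow_of`: the Mumford–Weil fibre with its tropical specialisation map (`stub_mumfordWeilFibre`, XL, open) +
the Weil–Hodge triple (this file) + extraction of effective cycles (`stub_extractEffective`, landed p273433) ⟹ the
crux BY NAME). After this file the line is, in the kernel, exactly `stub_mumfordWeilFibre`.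

**Theorem** (`stub_weilHodgeTriple`, the registered signature verbatim). For a complex abelian eightfold `A` with
`φ ≫ φ = -𝟙`, a projective embedding `e` and a non-zero rational `a ∈ H²(ℙᴺ(ℂ); ℂ)` such that `(A, φ)` is HYPERBOLIC
for the `K`-symmetrised class `h_K = e^*a + φ^*e^*a`, there are rational `(4,4)`-classes `u₀, u₁, u₂ ∈ H⁸(A(ℂ); ℂ)`
with `u₁, u₂` in the Weil plane `weilClassesOf A φ 4 1` and a NON-DEGENERATE cup product on their `ℚ`-span: for every
`l ≠ 0` in `ℚ³`, `(Σ lₖ uₖ) ⌣ u_{k'} ≠ 0` for some `k'`.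

Proof (all inputs are theorems of the tree). `u₀ := h_K⁴` with `h_K` rational of type `(1,1)` and a non-zero real
multiple `s·H'` of a Kähler class (`isRationalClass_ksymm`, `isOfHodgeType_one_one_ksymm`,
`exists_isKaehlerClass_ksymm_eq_smul`), so `u₀` is rational of type `(4,4)` (`IsRationalClass.cupPowTwo`,
`isOfHodgeType_cupPowTwo`) and `u₀ ⌣ u₀ = h_K⁸ = s⁸ H'⁸ ≠ 0` (§1 `cupProduct_cupPowTwo_cupPowTwo`, `cupPowTwo_smul`,
`IsKaehlerClass.cupPowTwo_ne_zero`). `u₁, u₂` := a rational pair spanning the Weil plane `W` (§2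
`exists_isRationalClass_pair_span_weilClassesOf`: `W` is the complex span of its rational classes,
`weilClassesOf_eq_span_isRationalClass`, of dimension `2`, `finrank_weilClassesOf_eq_two`), of type `(4,4)` because
hyperbolic Weil type is balanced (`isOfHodgeType_of_mem_weilClassesOf_of_isHyperbolicWeilType`, Deligne–Milne 4.8/4.4).
Cross terms vanish: `φ^*h_K = h_K` (`map_ksymm_eq_smul`), so `h_K⁴ ⌣ W = 0`
(`cupProduct_cupPowTwo_eq_zero_of_map_eq_smul_of_mem_weilClassesOf`; even classes commute,
`cupPowTwo_cupProduct_comm`). Hence for `l₀ ≠ 0`, `(Σ lₖ uₖ) ⌣ u₀ = l₀ h_K⁸ ≠ 0`; for `l₀ = 0`,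
`w = l₁u₁ + l₂u₂ ≠ 0` lies in `W`, where the cup form is non-degenerate (§2
`exists_cupProduct_ne_zero_of_mem_weilClassesOf`: along the Weil lines `w = αP + βM` with `P ⌣ M ≠ 0`,
`P ⌣ P = M ⌣ M = 0`, from `exists_weilLines_generators`, `cupProduct_ne_zero_of_mem_weilClassesPlus_of_mem_weilClassesMinus`,
`cupProduct_self_eq_zero_of_mem_weilClasses{Plus,Minus}`, graded commutativity), and `W = span{u₁, u₂}`.

HONEST STATUS. Linear algebra of the Weil plane of a hyperbolic Weil eightfold; nothing here is a case of the Hodge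
conjecture. The Mumford–Weil fibre `stub_mumfordWeilFibre` (degeneration, tropical homology, effectivity) remains the
crux of the line. No definition, no named fact, no sorry.
References: [vanGeemen1994HodgeAV] 4.9–4.11, Lemma 5.2, proof of Thm. 6.12; [Deligne1982HodgeCycles] Prop. 4.4,
Thm. 4.8; [VoisinHodgeI2002] §3.1.3 Cor. 3.9, §7.1.2; [Schoen1998HodgeWeilAddendum] §10; [HatcherAT2002] §3.2.
-/

set_option linter.dupNamespace false

noncomputable section

open CategoryTheory
open Literature.AlgebraicGeometry Literature.AlgebraicGeometry.Motives
open Literature.AlgebraicGeometry.HodgeTheory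
open Literature.AlgebraicTopology.SingularHomology
open scoped BigOperators

namespace Summit.HodgeConjecture.HodgeConjecture.Theorems.MumfordWeilShadow

/-! ## §1 Cup powers multiply: `xⁱ ⌣ xʲ = x^{i+j}` -/

/-- **`xⁱ ⌣ xʲ = xⁱ⁺ʲ`** for the cup powers of a degree-`2` class (associativity of the cup product).
[cite: HatcherAT2002, §3.2 Prop. 3.10 and p. 211] -/
theorem cupProduct_cupPowTwo_cupPowTwo {Y : Type} [TopologicalSpace Y] (x : singularCohomology ℂ ℂ Y 2)
    (i : ℕ) : ∀ (j : ℕ) (h : 2 * i + 2 * j = 2 * (i + j)),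
      cupProduct h (cupPowTwo x i) (cupPowTwo x j) = cupPowTwo x (i + j)
  | 0, _ => cupProduct_one _
  | j + 1, h => by
    have h' : 2 * i + 2 * j = 2 * (i + j) := by omega
    show cupProduct h (cupPowTwo x i) (cupPowTwo x (j + 1)) = cupPowTwo x (i + j + 1)
    rw [cupPowTwo_succ x (i + j), cupPowTwo_succ x j, ← cupProduct_cupPowTwo_cupPowTwo x i j h']
    exact (cupProduct_assoc h' (two_mul_add_two j) (two_mul_add_two (i + j)) h _ _ _).symm

/-! ## §2 The Weil plane of an abelian `2n`-fold: a rational spanning pair, and non-degeneracy -/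

section WeilPlane

variable {A : AbelianVariety ℂ}

/-- **The Weil plane has a RATIONAL basis**: for `φ ≫ φ = -d`, `n, d ≥ 1`, `dim A = 2n`, there are
rational classes `u₁, u₂ ∈ W_K ⊗ ℂ = weilClassesOf A φ n d`, linearly independent over `ℂ`, spanning
the plane (`W` is the complex span of its rational classes, `weilClassesOf_eq_span_isRationalClass`, and
has dimension `2`, `finrank_weilClassesOf_eq_two`). [cite: vanGeemen1994HodgeAV, 4.9 (PDF p. 218)] -/
theorem exists_isRationalClass_pair_span_weilClassesOf {n d : ℕ} (hn : 0 < n) (hA : A.dim = 2 * n)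
    (hd : 0 < d) {φ : A ⟶ A} (hφ : φ ≫ φ = -(d • 𝟙 A)) :
    ∃ u₁ u₂ : complexBetti A.X (2 * n),
      IsRationalClass u₁ ∧ IsRationalClass u₂ ∧ u₁ ∈ weilClassesOf A φ n d ∧
        u₂ ∈ weilClassesOf A φ n d ∧ LinearIndependent ℂ ![u₁, u₂] ∧
        weilClassesOf A φ n d ≤ Submodule.span ℂ (Set.range ![u₁, u₂]) := by
  haveI := finite_complexBetti_abelianVariety A (2 * n)
  have hΛ := Motives.AbelianVariety.hasExteriorCohomologyH1_complexPoints A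
  have hb₁ : Module.finrank ℂ (complexBetti A.X 1) = 2 * (2 * n) := by
    rw [Motives.AbelianVariety.finrank_complexBetti_one, hA]
  have h2 := finrank_weilClassesOf_eq_two hΛ hb₁ hn hd hφ
  obtain ⟨u₁, hu₁W, hu₁0, hu₁r⟩ := exists_isRationalClass_ne_zero_mem_weilClassesOf hn hA hd hφ
  -- a second rational class of the plane off the line `ℂ u₁`
  obtain ⟨u₂, hu₂r, hu₂W, hu₂⟩ : ∃ u₂ : complexBetti A.X (2 * n), IsRationalClass u₂ ∧
      u₂ ∈ weilClassesOf A φ n d ∧ u₂ ∉ Submodule.span ℂ {u₁} := by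
    by_contra! hall
    have hle : weilClassesOf A φ n d ≤ Submodule.span ℂ {u₁} := by
      rw [weilClassesOf_eq_span_isRationalClass hn hA hd hφ, Submodule.span_le]
      rintro c ⟨hcr, hcw⟩
      exact hall c hcr hcw
    have h1 : Module.finrank ℂ (Submodule.span ℂ ({u₁} : Set (complexBetti A.X (2 * n)))) = 1 :=
      finrank_span_singleton hu₁0
    have := Submodule.finrank_mono hle
    omega
  have hli : LinearIndependent ℂ ![u₁, u₂] := by
    refine LinearIndependent.pair_iff.2 fun s t hst ↦ ?_
    by_cases ht : t = 0
    · subst ht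
      rw [zero_smul, add_zero] at hst
      exact ⟨(smul_eq_zero.1 hst).resolve_right hu₁0, rfl⟩
    · exfalso
      apply hu₂
      rw [Submodule.mem_span_singleton]
      refine ⟨-(t⁻¹ * s), ?_⟩
      have : t • u₂ = -(s • u₁) := eq_neg_of_add_eq_zero_right hst
      calc -(t⁻¹ * s) • u₁ = t⁻¹ • (-(s • u₁)) := by rw [neg_smul, mul_smul, smul_neg]
        _ = u₂ := by rw [← this, smul_smul, inv_mul_cancel₀ ht, one_smul]
  refine ⟨u₁, u₂, hu₁r, hu₂r, hu₁W, hu₂W, hli, ?_⟩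
  -- the span of an independent pair inside the plane is the plane
  haveI : FiniteDimensional ℂ (weilClassesOf A φ n d) := Module.finite_of_finrank_eq_succ h2
  have hle : Submodule.span ℂ (Set.range ![u₁, u₂]) ≤ weilClassesOf A φ n d := by
    rw [Submodule.span_le]
    rintro _ ⟨k, rfl⟩
    fin_cases k
    · exact hu₁W
    · exact hu₂W
  have hcard : Module.finrank ℂ (Submodule.span ℂ (Set.range ![u₁, u₂])) = 2 := by
    rw [finrank_span_eq_card hli, Fintype.card_fin]
  exact (Submodule.eq_of_le_of_finrank_le hle (by rw [h2, hcard])).ge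

/-- **Non-degeneracy of the cup product on the Weil plane**: for `dim A = 2n`, `φ ≫ φ = -d`,
`n, d ≥ 1`, a non-zero class `w` of the Weil plane pairs non-trivially with the plane
(`w = α P + β M` along the two Weil lines, `P ⌣ M ≠ 0`, `P ⌣ P = M ⌣ M = 0`, so `w ⌣ M = α (P ⌣ M)` and
`w ⌣ P = β (P ⌣ M)`). [cite: vanGeemen1994HodgeAV, 4.9–4.11 and proof of Thm. 6.12]
[cite: Schoen1998HodgeWeilAddendum, §10] -/
theorem exists_cupProduct_ne_zero_of_mem_weilClassesOf {n d : ℕ} (hn : 0 < n) (hA : A.dim = 2 * n)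
    (hd : 0 < d) {φ : A ⟶ A} (hφ : φ ≫ φ = -(d • 𝟙 A)) {k : ℕ} (hk : 2 * n + 2 * n = k)
    {w : complexBetti A.X (2 * n)} (hw : w ∈ weilClassesOf A φ n d) (hw0 : w ≠ 0) :
    ∃ y ∈ weilClassesOf A φ n d, cupProduct hk w y ≠ 0 := by
  haveI := finite_complexBetti_abelianVariety A 1
  have hΛ := Motives.AbelianVariety.hasExteriorCohomologyH1_complexPoints A
  have hb₁ : Module.finrank ℂ (complexBetti A.X 1) = 2 * (2 * n) := by
    rw [Motives.AbelianVariety.finrank_complexBetti_one, hA]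
  -- non-zero generators of the two Weil lines
  obtain ⟨P, M, hP, hM, hPM, -, -⟩ := exists_weilLines_generators hb₁ hn hd hφ
  have hP0 : P ≠ 0 := fun h ↦ hPM (by rw [h, LinearMap.map_zero₂])
  have hM0 : M ≠ 0 := fun h ↦ hPM (by rw [h, map_zero])
  have hPMk : cupProduct hk P M ≠ 0 :=
    cupProduct_ne_zero_of_mem_weilClassesPlus_of_mem_weilClassesMinus hb₁ hn hd hφ hk hP hM hP0 hM0
  have hPP : cupProduct hk P P = 0 := cupProduct_self_eq_zero_of_mem_weilClassesPlus hb₁ hn hd hφ hk hP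
  have hMM : cupProduct hk M M = 0 := cupProduct_self_eq_zero_of_mem_weilClassesMinus hb₁ hn hd hφ hk hM
  have hMP : cupProduct hk M P = cupProduct hk P M := by
    rw [cupProduct_gradedComm_holds ℂ _ hk hk M P]
    have : Even (2 * n * (2 * n)) := ⟨2 * n * n, by ring⟩
    rw [this.neg_one_pow, one_smul]
  -- `w = α P + β M`
  obtain ⟨p, hp, m, hm, rfl⟩ := Submodule.mem_sup.mp hw
  obtain ⟨α, rfl⟩ := Submodule.mem_span_singleton.mp
    (weilClassesPlus_le_span_singleton hΛ hb₁ hd hφ hP hP0 hp)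
  obtain ⟨β, rfl⟩ := Submodule.mem_span_singleton.mp
    (weilClassesMinus_le_span_singleton hΛ hb₁ hd hφ hM hM0 hm)
  by_cases hα : α = 0
  · -- `w = β M`, `β ≠ 0`: pair with `P`
    subst hα
    have hβ : β ≠ 0 := by rintro rfl; exact hw0 (by simp)
    refine ⟨P, weilClassesPlus_le_weilClassesOf A φ n d hP, ?_⟩
    rw [zero_smul, zero_add, LinearMap.map_smul₂, hMP]
    exact smul_ne_zero hβ hPMk
  · -- `α ≠ 0`: pair with `M`
    refine ⟨M, weilClassesMinus_le_weilClassesOf A φ n d hM, ?_⟩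
    rw [map_add, LinearMap.add_apply, LinearMap.map_smul₂, LinearMap.map_smul₂, hMM, smul_zero,
      add_zero]
    exact smul_ne_zero hα hPMk

end WeilPlane

/-! ## §3 The stub, in the registered spelling -/

/-- **Stub `stub_weilHodgeTriple` of crux `MumfordWeilShadow` (registered signature, verbatim): the
cup-non-degenerate Weil–Hodge triple of a hyperbolic Weil eightfold.** `u₀ = h_K⁴` for the
`K`-symmetrised hyperplane class `h_K = e^*a + φ^*e^*a` (a non-zero real multiple of a Kähler class,
`exists_isKaehlerClass_ksymm_eq_smul`, so `h_K⁸ ≠ 0`), `u₁, u₂` a rational basis of the Weil plane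
(`exists_isRationalClass_pair_span_weilClassesOf`), of type `(4,4)` by hyperbolic ⇒ balanced
(`isOfHodgeType_of_mem_weilClassesOf_of_isHyperbolicWeilType`); `h_K⁴ ⌣ W = 0`
(`cupProduct_cupPowTwo_eq_zero_of_map_eq_smul_of_mem_weilClassesOf` with `φ^*h_K = h_K`,
`map_ksymm_eq_smul`), and the cup form is non-degenerate on `W` (§2). [cite: vanGeemen1994HodgeAV, 4.9–4.11 and proof of Thm. 6.12]
[cite: Deligne1982HodgeCycles, Thm. 4.8 and Prop. 4.4] [cite: VoisinHodgeI2002, §3.1.3 Cor. 3.9] -/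
theorem stub_weilHodgeTriple :
    ∀ (A : AbelianVariety ℂ) (φ : A ⟶ A) (e : ProjectiveEmbedding A.X)
      (a : complexBetti (projectiveSpace e.n ℂ) 2),
      A.dim = 8 → φ ≫ φ = -(𝟙 A) → IsRationalClass a → a ≠ 0 →
      IsHyperbolicWeilType A φ 4
        (complexBetti.map e.ι 2 a + complexBetti.map φ.hom.hom.hom 2 (complexBetti.map e.ι 2 a)) →
      ∃ u : Fin 3 → complexBetti A.X (2 * 4),
        (∀ k, IsRationalClass (u k) ∧ IsOfHodgeType 8 A.X (2 * 4) 4 4 (u k)) ∧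
        u 1 ∈ weilClassesOf A φ 4 1 ∧ u 2 ∈ weilClassesOf A φ 4 1 ∧
        (∀ l : Fin 3 → ℚ, l ≠ 0 →
          ∃ k', cupProduct (show 2 * 4 + 2 * 4 = 16 by norm_num) (∑ k, ((l k : ℚ) : ℂ) • u k) (u k') ≠ 0) := by
  intro A φ e a hdim hφ ha ha0 hhyp
  -- normalisations: `d = 1`, `dim A = 2·4 = 7+1`
  have hA : A.dim = 2 * 4 := hdim
  have hA8 : A.dim = 7 + 1 := hdim
  have hX : IsSmoothProjective 8 A.X := Motives.isSmoothProjective_of_dim_eq' hdim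
  have hφ' : φ ≫ φ = -((1 : ℕ) • 𝟙 A) := by rwa [one_smul]
  set h := complexBetti.map e.ι 2 a with hhdef
  set K := h + complexBetti.map φ.hom.hom.hom 2 h with hKdef
  have hK1 : ((1 : ℕ) : ℂ) • h + complexBetti.map φ.hom.hom.hom 2 h = K := by
    rw [Nat.cast_one, one_smul]
  have hhyp' : IsHyperbolicWeilType A φ 4 (((1 : ℕ) : ℂ) • h + complexBetti.map φ.hom.hom.hom 2 h) := by
    rw [hK1]; exact hhyp
  have hKrat : IsRationalClass K := by
    have := isRationalClass_ksymm 1 φ e ha; rwa [hK1] at this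
  have hK11 : IsOfHodgeType (7 + 1) A.X 2 1 1 K := by
    have := isOfHodgeType_one_one_ksymm hA8 Nat.one_pos φ e ha ha0; rwa [hK1] at this
  have hKφ : complexBetti.map φ.hom.hom.hom 2 K = ((1 : ℕ) : ℂ) • K := by
    have := map_ksymm_eq_smul hφ' h; rwa [hK1] at this
  obtain ⟨s, H', hs0, hH', hsK⟩ := exists_isKaehlerClass_ksymm_eq_smul hA8 Nat.one_pos φ e ha ha0
  rw [hK1] at hsK
  -- `h_K⁸ ≠ 0`
  have hK8 : cupPowTwo K 8 ≠ 0 := by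
    rw [hsK, cupPowTwo_smul]
    exact smul_ne_zero (pow_ne_zero _ (Complex.ofReal_ne_zero.2 hs0))
      (hH'.cupPowTwo_ne_zero hX (p := 8) (by norm_num) le_rfl)
  have h16 : 2 * 4 + 2 * 4 = 16 := by norm_num
  have hK44 : cupProduct h16 (cupPowTwo K 4) (cupPowTwo K 4) ≠ 0 := by
    have e8 : cupProduct (show 2 * 4 + 2 * 4 = 2 * (4 + 4) by norm_num) (cupPowTwo K 4) (cupPowTwo K 4) =
        cupPowTwo K (4 + 4) := cupProduct_cupPowTwo_cupPowTwo K 4 4 _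
    intro h0
    apply hK8
    have : cupPowTwo K 8 = cupProduct h16 (cupPowTwo K 4) (cupPowTwo K 4) := e8.symm
    rw [this, h0]
  -- `h_K⁴ ⌣ w = 0 = w ⌣ h_K⁴` for `w` in the Weil plane
  have hKW : ∀ w ∈ weilClassesOf A φ 4 1, cupProduct h16 w (cupPowTwo K 4) = 0 := by
    intro w hw
    rw [← HodgeRiemannDegreeOne.cupPowTwo_cupProduct_comm K 4 (2 * 4) 16 h16 h16 w]
    exact cupProduct_cupPowTwo_eq_zero_of_map_eq_smul_of_mem_weilClassesOf hA Nat.one_pos hφ' hKφ hw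
      (i := 4) (by norm_num) h16
  -- the rational spanning pair of the Weil plane
  obtain ⟨u₁, u₂, hu₁r, hu₂r, hu₁W, hu₂W, hli, hspan⟩ :=
    exists_isRationalClass_pair_span_weilClassesOf (n := 4) (by norm_num) hA Nat.one_pos hφ'
  refine ⟨![cupPowTwo K 4, u₁, u₂], ?_, hu₁W, hu₂W, ?_⟩
  · intro k
    fin_cases k
    · exact ⟨hKrat.cupPowTwo 4, isOfHodgeType_cupPowTwo hX hK11 4⟩
    · exact ⟨hu₁r, isOfHodgeType_of_mem_weilClassesOf_of_isHyperbolicWeilType (n := 4) (by norm_num)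
        Nat.one_pos hA hφ' e ha ha0 hhyp' hu₁W⟩
    · exact ⟨hu₂r, isOfHodgeType_of_mem_weilClassesOf_of_isHyperbolicWeilType (n := 4) (by norm_num)
        Nat.one_pos hA hφ' e ha ha0 hhyp' hu₂W⟩
  · intro l hl
    by_cases hl0 : l 0 = 0
    · -- `w = l₁ u₁ + l₂ u₂ ≠ 0` in the Weil plane: pair inside the plane
      have hw : ∑ k, ((l k : ℚ) : ℂ) • ![cupPowTwo K 4, u₁, u₂] k =
          ((l 1 : ℚ) : ℂ) • u₁ + ((l 2 : ℚ) : ℂ) • u₂ := by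
        simp [Fin.sum_univ_three, hl0]
      have hwW : ((l 1 : ℚ) : ℂ) • u₁ + ((l 2 : ℚ) : ℂ) • u₂ ∈ weilClassesOf A φ 4 1 :=
        Submodule.add_mem _ (Submodule.smul_mem _ _ hu₁W) (Submodule.smul_mem _ _ hu₂W)
      have hw0 : ((l 1 : ℚ) : ℂ) • u₁ + ((l 2 : ℚ) : ℂ) • u₂ ≠ 0 := by
        intro h0
        obtain ⟨h1, h2⟩ := (LinearIndependent.pair_iff.1 hli) _ _ h0
        apply hl
        funext k
        fin_cases k
        · exact hl0
        · exact_mod_cast h1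
        · exact_mod_cast h2
      obtain ⟨y, hyW, hy⟩ := exists_cupProduct_ne_zero_of_mem_weilClassesOf (n := 4) (by norm_num) hA
        Nat.one_pos hφ' h16 hwW hw0
      -- `y = c₁ u₁ + c₂ u₂`, so one of `w ⌣ u₁`, `w ⌣ u₂` is non-zero
      obtain ⟨c, hc⟩ := Submodule.mem_span_range_iff_exists_fun ℂ |>.mp (hspan hyW)
      rw [Fin.sum_univ_two] at hc
      by_contra! hall
      have h1 := hall 1
      have h2 := hall 2
      simp only [hw, Matrix.cons_val_one, Matrix.cons_val_two, Matrix.head_cons, Matrix.tail_cons] at h1 h2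
      apply hy
      rw [← hc, map_add, map_smul, map_smul]
      simp only [Matrix.cons_val_zero, Matrix.cons_val_one] at h1 h2 ⊢
      rw [h1, h2, smul_zero, smul_zero, add_zero]
    · -- `l₀ ≠ 0`: pair with `u₀ = h_K⁴`
      refine ⟨0, ?_⟩
      simp only [Fin.sum_univ_three, Matrix.cons_val_zero, Matrix.cons_val_one, Matrix.cons_val_two,
        Matrix.head_cons, Matrix.tail_cons, map_add, LinearMap.add_apply, LinearMap.map_smul₂,
        hKW u₁ hu₁W, hKW u₂ hu₂W, smul_zero, add_zero]
      exact smul_ne_zero (by exact_mod_cast hl0) hK44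

end Summit.HodgeConjecture.HodgeConjecture.Theorems.MumfordWeilShadow

end
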